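import Summits.AtomisticToContinuum.Crystallization.Theorems.PalmUnimodularRigidityLayeredLawsSelectHcpLocalChartIffBall
import Summits.AtomisticToContinuum.Crystallization.Theorems.PalmUnimodularRigidityLayeredLawsSelectHcpCorrBijection

/-!
# Crux `LayeredLawsSelectHcp` (stmt-AtomisticToContinuum-9226), line `mtp-prestress-split-ergodic-frame`:
# the hat label of a ball label is a ball label (R3′, lead c3)

Combinatorial input of the zero-mean theorem for directed orbit-sum correctors with BALL-admissible data
(`tube_correctorMeanZero_ball`, `…CorrMeanZeroBall.lean`; the ball version of `hat_mem_nearBall` of `…CorrMeanZeroPrelude.lean`, there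
by `decide` on the 57 near-ball labels).  The received mass of the Mecke transport of a datum with shift `c` is read through charts
re-rooted at the HAT LABEL `ĉ` (`−c` on even layers, `c` on odd layers: `labelShift ĉ` is the inverse index map of `labelShift c`,
`tube_reRoot_involution`), so the counting evaluation on the graph ball `ballLabels n` needs `ĉ ∈ ballLabels n` for `c ∈ ballLabels n`
(registered sub-goal `hat_mem_ballLabels`, the anchor).  Proof without enumeration, for every radius: the graph ball is the set of
endpoints of label paths of length `n` from the root each of whose steps is trivial or an ideal unit strut (`mem_ballLabels_iff_path`;
touching is being a labelled neighbour, `dist_ideal_eq_one_iff_nbr`), and the index map `labelShift ĉ` — an isometry of the ideal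
labels (`dist_hcpSite_labelShift`) with `labelShift ĉ c = 0` (`labelShift_inv_apply_self`) and `labelShift ĉ 0 = ĉ` (`labelShift_zero`) —
carries the reversed path `c ⇝ 0` to a path `0 ⇝ ĉ` of the same length.  All `[folklore]`.
-/

noncomputable section

namespace Summit.AtomisticToContinuum.Crystallization.Theorems.PalmUnimodularRigidity.LayeredLawsSelectHcp

open MeasureTheory Set
open Literature.MathematicalPhysics.StatisticalMechanics Literature.Geometry.DiscreteGeometry

/-! ## Graph balls as sets of path endpoints -/

/-- **The graph ball as a set of path endpoints**: `w ∈ ballLabels n` iff there is a label path `p₀ = 0, p₁, …, pₙ = w` each of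
whose steps is trivial or an ideal unit strut (`dist_ideal_eq_one_iff_nbr`: touching is being a labelled neighbour). [folklore] -/
theorem mem_ballLabels_iff_path (n : ℕ) (w : ℤ × ℤ × ℤ) :
    w ∈ ballLabels n ↔ ∃ p : ℕ → ℤ × ℤ × ℤ, p 0 = 0 ∧ p n = w ∧
      ∀ i < n, p (i + 1) = p i ∨
        dist (hcpSite 1 (Real.sqrt (2 / 3)) (p i)) (hcpSite 1 (Real.sqrt (2 / 3)) (p (i + 1))) = 1 := by
  induction n generalizing w with
  | zero =>
    constructor
    · intro hw
      have hw0 : w = 0 := Finset.mem_singleton.1 hw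
      exact ⟨fun _ => 0, rfl, hw0.symm, fun i hi => absurd hi (Nat.not_lt_zero i)⟩
    · rintro ⟨p, hp0, hpw, -⟩
      rw [← hpw, hp0]
      exact Finset.mem_singleton_self _
  | succ n ih =>
    constructor
    · intro hw
      obtain ⟨v, hv, hvw⟩ := LocalChartIffBall.exists_of_mem_ballLabels_succ hw
      obtain ⟨p, hp0, hpv, hstep⟩ := (ih v).1 hv
      refine ⟨fun i => if i ≤ n then p i else w, ?_, ?_, fun i hi => ?_⟩
      · show (if 0 ≤ n then p 0 else w) = 0
        rw [if_pos (Nat.zero_le n), hp0]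
      · show (if n + 1 ≤ n then p (n + 1) else w) = w
        rw [if_neg (Nat.not_succ_le_self n)]
      · show (if i + 1 ≤ n then p (i + 1) else w) = (if i ≤ n then p i else w) ∨
          dist (hcpSite 1 (Real.sqrt (2 / 3)) (if i ≤ n then p i else w))
            (hcpSite 1 (Real.sqrt (2 / 3)) (if i + 1 ≤ n then p (i + 1) else w)) = 1
        rcases Nat.lt_succ_iff_lt_or_eq.1 hi with hi' | rfl
        · rw [if_pos (Nat.succ_le_of_lt hi'), if_pos hi'.le]
          exact hstep i hi'
        · rw [if_neg (Nat.not_succ_le_self i), if_pos le_rfl, hpv]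
          rcases hvw with rfl | ⟨ε, hε, rfl⟩
          · exact Or.inl rfl
          · exact Or.inr ((dist_ideal_eq_one_iff_nbr v _).2 ⟨ε, hε, rfl⟩)
    · rintro ⟨p, hp0, hpw, hstep⟩
      have hv : p n ∈ ballLabels n := (ih (p n)).2 ⟨p, hp0, rfl, fun i hi => hstep i (Nat.lt_succ_of_lt hi)⟩
      rw [← hpw]
      rcases hstep n (Nat.lt_succ_self n) with h | h
      · rw [h]
        exact ballLabels_mono n hv
      · obtain ⟨ε, hε, hε'⟩ := (dist_ideal_eq_one_iff_nbr (p n) (p (n + 1))).1 h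
        rw [hε']
        exact nbr_mem_ballLabels_succ n (p n) hv ε hε

/-! ## The hat label -/

/-- **Registered sub-goal `hat_mem_ballLabels` (anchor) — the hat label `ĉ` (`−c` on even layers, `c` on odd layers) of a ball
label `c` is a ball label**: the index map `labelShift ĉ` preserves the ideal distances (`dist_hcpSite_labelShift`) and sends `c ↦ 0`,
`0 ↦ ĉ` (`labelShift_inv_apply_self`, `labelShift_zero`), so it carries the reversed path `c ⇝ 0` to a path `0 ⇝ ĉ` of the same
length. [folklore] -/
theorem hat_mem_ballLabels : ∀ (n : ℕ), ∀ c ∈ ballLabels n, (if Even c.1 then -c else c) ∈ ballLabels n := by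
  intro n c hc
  obtain ⟨p, hp0, hpc, hstep⟩ := (mem_ballLabels_iff_path n c).1 hc
  refine (mem_ballLabels_iff_path n _).2 ⟨fun i => labelShift (if Even c.1 then -c else c) (p (n - i)), ?_, ?_, ?_⟩
  · show labelShift (if Even c.1 then -c else c) (p (n - 0)) = 0
    rw [Nat.sub_zero, hpc]
    exact labelShift_inv_apply_self c
  · show labelShift (if Even c.1 then -c else c) (p (n - n)) = (if Even c.1 then -c else c)
    rw [Nat.sub_self, hp0]
    exact labelShift_zero _
  · intro i hi
    have h1 : n - i = n - (i + 1) + 1 := by omega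
    show labelShift (if Even c.1 then -c else c) (p (n - (i + 1))) = labelShift (if Even c.1 then -c else c) (p (n - i)) ∨
      dist (hcpSite 1 (Real.sqrt (2 / 3)) (labelShift (if Even c.1 then -c else c) (p (n - i))))
        (hcpSite 1 (Real.sqrt (2 / 3)) (labelShift (if Even c.1 then -c else c) (p (n - (i + 1))))) = 1
    rcases hstep (n - (i + 1)) (by omega) with h | h
    · left
      rw [h1, h]
    · right
      rw [dist_hcpSite_labelShift, h1, dist_comm]
      exact h

end Summit.AtomisticToContinuum.Crystallization.Theorems.PalmUnimodularRigidity.LayeredLawsSelectHcp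

end
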